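import Literature.NumberTheory.EllipticCurves.SupersingularPPowerTorsionKernelOfReductionProofs
import Literature.NumberTheory.EllipticCurves.Serre1967.TorsionValuationIterationProofs
import Literature.NumberTheory.EllipticCurves.Serre1967.StableDivisibleLineStructureProofs
import Mathlib.Analysis.SpecialFunctions.Log.Basic
import HarnessLib

/-!
# Serre 1967, §5 Prop. 8 (torsion form) — the ABSTRACT assembly: no stable `p`-divisible line on an
# elliptic curve over a valued field at a «supersingular» place, granted the degree/valuation bound
# (proofs only)

`Proofs`-style file (THEOREMS ONLY), topic `NumberTheory/EllipticCurves`, paper group `Serre1967`.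
J.-P. Serre, *Sur les groupes de Galois attachés aux groupes p-divisibles* (Driebergen 1966), §5
Prop. 8: the Tate module of a connected one-dimensional `p`-divisible group over a complete discretely
valued field is simple under the Lie algebra of the Galois image; for elliptic curves at a potentially
supersingular place: no `ℤ_p`-line of `T_pE` is stable under an open subgroup of the local Galois
group, i.e. (torsion form, the tree's named fact
`Serre1967.noStableDivisibleLine_of_potentiallySupersingular`) `E[p^∞]` has no non-zero stable
`p`-divisible subgroup with `≤ p` points killed by `p`. This file assembles the tree's bricks into the
statement in ABSTRACT form — over any valued field `(L, |·|)`, for any Weierstrass equation `W` whose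
`p`-division polynomials have the supersingular shape, and for ANY monoid `D` acting on `W(L)` by group
endomorphisms — granted ONE arithmetic hypothesis, the **degree/valuation bound**
(`hlow`): a point `P = (x, y)` of the kernel of reduction (`|x| > 1`) whose `D`-orbit has at most `m`
elements satisfies `log |x| ≥ b/m` for a fixed `b > 0`. (For `L = K̄_v`, `D = Gal(K̄_v/K_v)` this is
«`x` has degree `≤ m` over `K_v`, so `|x|^m ≥ |x|^{deg x} = |a₀| ≥ |ϖ_v|⁻¹`», Serre's
`v(x) ≥ c₄/e`.) The proof is Serre's: a non-zero such `N` contains a chain `Pₙ` of exact order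
`p^{n+1}` with `p·P_{n+1} = Pₙ` and cyclic levels (`StableDivisibleLineStructureProofs`), every `Pₙ`
lies in the kernel of reduction (`SupersingularPPowerTorsionKernelOfReductionProofs`), `sₙ = log|x(Pₙ)|`
obeys the contraction `q·s_{n+1} ≤ sₙ ∨ s_{n+1} ≤ sₙ − c`, `q = p²`
(`SupersingularMultiplicationByPValuationProofs`), the `D`-orbit of `Pₙ` has `≤ p^{n+1}` elements so
`sₙ ≥ (b/p)/pⁿ` (`hlow`), and `r = p < q = p²` is the contradiction of
`TorsionValuationIterationProofs`.

* `Serre1967.eq_bot_of_stable_divisible_of_contraction` — the assembly.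

What is NOT here (the remaining instantiation for the named fact): `L = \bar{K_v}` with the spectral
valuation, `W` = a good supersingular model (the supersingular shape of `ΨSq_p` is
`coeff_ΨSq_prime_localMinimalIntegralModel_mem_maximalIdeal`), `D = D_𝔭` through
`GreenbergSelmer.decomp`, and the degree/valuation bound `hlow` over `K_v` (cf. the tree's
`le_natDegree_minpoly_X_of_prime_smul_eq_zero` over `ℚ_p`).

## References

* J.-P. Serre, Proc. Conf. Local Fields (Driebergen 1966), Springer 1967, 118–131, §5 Prop. 8 and
  Lemme 3. [Serre1967GroupesPDivisibles]
* J. H. Silverman, *The Arithmetic of Elliptic Curves*, 2nd ed. (2009), VII.3, Exercise 3.7. [SilvermanAEC2009]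
-/

noncomputable section

open scoped Classical NNReal

namespace Literature.NumberTheory.EllipticCurves.Serre1967

open WeierstrassCurve Polynomial

variable {L : Type*} [Field L] (w : Valuation L ℝ≥0) (W : WeierstrassCurve L) (p : ℕ)
  [hp : Fact p.Prime] {D : Type*} [Monoid D] [DistribMulAction D W.toAffine.Point]

/-- **Serre 1967, §5 Prop. 8 in torsion form — abstract assembly.** Let `(L, |·|)` be a valued
field, `W` a Weierstrass equation over `L` whose `p`-division polynomials have the supersingular shape
(`|coeff_j Φ_p| ≤ 1`; `|coeff₀ ΨSq_p| = 1`; `|coeff_j ΨSq_p| ≤ μ < 1` for `j ≥ 1`), `D` a monoid acting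
on `W(L)` by additive maps, and suppose the degree/valuation bound: for some `b > 0`, every affine
point `(x, y)` with `|x| > 1` whose `D`-orbit is finite with at most `m` elements (`m ≥ 1`) has
`b/m ≤ log |x|`. Then a `D`-stable subgroup `N` of `W(L)` consisting of `p`-power torsion, `p`-divisible
inside itself, whose `p`-torsion is finite with at most `p` elements, is trivial.
[cite: Serre1967GroupesPDivisibles, §5 Prop. 8] -/
theorem eq_bot_of_stable_divisible_of_contraction (μ : ℝ≥0) (hμ1 : μ < 1)
    (hΦ : ∀ j, w ((W.Φ p).coeff j) ≤ 1) (hΨ0 : w ((W.ΨSq p).coeff 0) = 1)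
    (hΨ : ∀ j, 1 ≤ j → w ((W.ΨSq p).coeff j) ≤ μ)
    (b : ℝ) (hb : 0 < b)
    (hlow : ∀ {x y : L} {h : W.toAffine.Nonsingular x y}, 1 < w x → ∀ {m : ℕ}, 1 ≤ m →
      (Set.range fun d : D => d • (WeierstrassCurve.Affine.Point.some x y h : W.toAffine.Point)).Finite →
      (Set.range fun d : D => d • (WeierstrassCurve.Affine.Point.some x y h : W.toAffine.Point)).ncard ≤ m →
      b / m ≤ Real.log (w x))
    (N : AddSubgroup W.toAffine.Point) (hstab : ∀ d : D, ∀ c ∈ N, d • c ∈ N)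
    (htors : ∀ c ∈ N, ∃ k : ℕ, p ^ k • c = 0) (hdiv : ∀ c ∈ N, ∃ c' ∈ N, p • c' = c)
    (hfin : {c : W.toAffine.Point | c ∈ N ∧ p • c = 0}.Finite)
    (hcard : Set.ncard {c : W.toAffine.Point | c ∈ N ∧ p • c = 0} ≤ p) : N = ⊥ := by
  by_contra hN
  have hp1 : 1 < p := hp.out.one_lt
  have hΨlt : ∀ j, 1 ≤ j → w ((W.ΨSq p).coeff j) < 1 := fun j hj => lt_of_le_of_lt (hΨ j hj) hμ1
  -- enlarge `μ` away from `0`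
  set μ' : ℝ≥0 := max μ 2⁻¹ with hμ'
  have hμ'1 : μ' < 1 := max_lt hμ1 (by rw [inv_lt_one_iff₀]; norm_num)
  have hμ'0 : 0 < μ' := lt_of_lt_of_le (by positivity) (le_max_right _ _)
  have hΨ' : ∀ j, 1 ≤ j → w ((W.ΨSq p).coeff j) ≤ μ' := fun j hj => le_trans (hΨ j hj) (le_max_left _ _)
  -- the chain
  obtain ⟨P, hPN, hP0, hpP0, hsucc⟩ := exists_chain_of_divisible p N htors hdiv hN
  have hord : ∀ n, addOrderOf (P n) = p ^ (n + 1) := addOrderOf_chain hP0 hpP0 hsucc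
  have hPne : ∀ n, P n ≠ 0 := fun n h0 => by
    have h := hord n
    rw [h0, addOrderOf_zero] at h
    exact (Nat.one_lt_pow (by omega) hp1).ne h
  -- coordinates of the chain
  have hcoords : ∀ n, ∃ (x y : L) (h : W.toAffine.Nonsingular x y), P n = WeierstrassCurve.Affine.Point.some x y h := by
    intro n
    rcases hPn : P n with _ | ⟨x, y, h⟩
    · exact absurd hPn (hPne n)
    · exact ⟨x, y, h, rfl⟩
  choose a c hac hPeq using hcoords
  -- every `Pₙ` is in the kernel of reduction
  have hkill : ∀ n, ((p : ℤ) ^ (n + 1)) • (WeierstrassCurve.Affine.Point.some (a n) (c n) (hac n) : W.toAffine.Point) = 0 :=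
    fun n => by
      rw [← hPeq n, ← Nat.cast_pow, natCast_zsmul, ← hord n, addOrderOf_nsmul_eq_zero]
  have ha : ∀ n, 1 < w (a n) := fun n =>
    W.one_lt_valuation_X_of_prime_pow_zsmul_eq_zero_of_ΨSq_shape w p hΦ hΨ0 hΨlt (k := n + 1)
      (Nat.le_add_left 1 n) (hkill n)
  have ha0 : ∀ n, (0 : ℝ) < w (a n) := fun n => lt_trans zero_lt_one (by exact_mod_cast ha n)
  -- the contraction in logarithms
  set s : ℕ → ℝ := fun n => Real.log (w (a n)) with hs
  set q : ℝ := (p : ℝ) ^ 2 with hq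
  set κ : ℝ := - Real.log μ' with hκ
  have hq1 : 1 < q := by
    rw [hq]; exact_mod_cast Nat.one_lt_pow two_ne_zero hp1
  have hκ0 : 0 < κ := by
    rw [hκ, neg_pos]
    exact Real.log_neg (by exact_mod_cast hμ'0) (by exact_mod_cast hμ'1)
  have hstep : ∀ n, q * s (n + 1) ≤ s n ∨ s (n + 1) ≤ s n - κ := by
    intro n
    have hmul : (p : ℤ) • (WeierstrassCurve.Affine.Point.some (a (n + 1)) (c (n + 1)) (hac (n + 1)) : W.toAffine.Point) =
        WeierstrassCurve.Affine.Point.some (a n) (c n) (hac n) := by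
      rw [← hPeq (n + 1), ← hPeq n, natCast_zsmul, hsucc n]
    rcases W.valuation_X_pow_sq_le_or_le_mul_of_zsmul_eq w p μ' hΦ hΨ0.le hΨ' (hac (n + 1))
      (ha (n + 1)) (hac n) hmul with h1 | h2
    · left
      have h1R : ((w (a (n + 1)) : ℝ)) ^ (p ^ 2) ≤ (w (a n) : ℝ) := by exact_mod_cast h1
      have := Real.log_le_log (pow_pos (ha0 (n + 1)) _) h1R
      rw [Real.log_pow] at this
      simpa [hs, hq] using this
    · right
      have h2R : (w (a (n + 1)) : ℝ) ≤ (μ' : ℝ) * (w (a n) : ℝ) := by exact_mod_cast h2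
      have := Real.log_le_log (ha0 (n + 1)) h2R
      rw [Real.log_mul (by positivity) (ha0 n).ne'] at this
      simp only [hs, hκ]
      linarith
  -- the lower bound from the orbit size
  have hlow' : ∀ n, (b / p) / (p : ℝ) ^ n ≤ s n := by
    intro n
    -- the orbit of `Pₙ` lies in the multiples `m • Pₙ`, `m < p^{n+1}`
    set S : Set W.toAffine.Point := (fun m : ℕ => m • P n) '' Set.Iio (p ^ (n + 1)) with hS
    have hSfin : S.Finite := (Set.finite_Iio _).image _
    have hsub : (Set.range fun d : D => d • P n) ⊆ S := by
      rintro _ ⟨d, rfl⟩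
      obtain ⟨m, hm, hdm⟩ := exists_smul_chain_eq_nsmul hstab hPN hP0 hpP0 hsucc hfin hcard d n
      exact ⟨m, hm, hdm.symm⟩
    have horbfin : (Set.range fun d : D => d • P n).Finite := hSfin.subset hsub
    have horb : (Set.range fun d : D => d • P n).ncard ≤ p ^ (n + 1) :=
      ncard_orbit_chain_le hstab hPN hP0 hpP0 hsucc hfin hcard n
    rw [hPeq n] at horbfin horb
    have h := hlow (ha n) (Nat.one_le_pow _ _ hp.out.pos) horbfin horb
    have e : (b / p) / (p : ℝ) ^ n = b / ((p ^ (n + 1) : ℕ) : ℝ) := by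
      rw [Nat.cast_pow, pow_succ, div_div, mul_comm]
    rw [e]
    exact h
  have hp0R : (0 : ℝ) < p := by exact_mod_cast hp.out.pos
  exact false_of_forall_mul_le_or_le_sub_of_forall_div_pow_le hq1 hκ0 hstep (div_pos hb hp0R)
    (by exact_mod_cast hp1.le) (by rw [hq, sq]; exact lt_mul_of_one_lt_left hp0R (by exact_mod_cast hp1))
    hlow'

end Literature.NumberTheory.EllipticCurves.Serre1967

end
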